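import Summits.BirchSwinnertonDyer.Rank1Residual.X2.MuTransferDerived
import Literature.NumberTheory.EllipticCurves.SelmerInftyTorsionFiniteProofs
import HarnessLib

/-!
# `Sel_{p^∞}(E/K_∞)[p]` finite ⟹ `X(E/K_∞)` is a finitely generated TORSION `Λ`-module with `μ = 0`
# (Greenberg, LNM 1716, proof of Prop. 5.10: "This obviously implies the conclusion")

HONEST FRAMING (BSD rank-`≤ 1` residual cell `b2b-bsdres`, home
`run/shared/lean/b2b/bsd-rank1-residual/`, unit `b2b-bsdres-eisenstein-p2`, class X2; research route,
no claim beyond stated classes; nothing booked here; labels unchanged): the cell deletes the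
COMBINATION-SHAPED residual classes of the rank-`≤ 1` BSD formula from PUBLISHED theorems only and
TYPES the construction-shaped ones; this is not "finishing BSD". PURE ALGEBRA + one bookkeeping
theorem, theorems only (no definition, no named fact, nothing asserted).

Greenberg (PDF p. 147): "We will show that `Sel_E(ℚ_∞)[p]` is finite. This obviously implies the
conclusion" (`Sel_E(ℚ_∞)_p` is `Λ`-cotorsion and `μ_E = 0`). The kernel needs the "obvious" step:
* §1 `exists_pow_X_smul_eq_zero_of_finite`: a FINITE `Λ`-module is killed by a power of `T`
  (pigeonhole on `T^i q` and the unit `1 − T^n`);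
* §2 **`isTorsion_of_finite_modN`**: a finitely generated `Λ`-module `M` with `M/pM` finite is
  `Λ`-torsion — `T^k M ⊆ pM` by §1, then the Cayley–Hamilton trick (Mathlib
  `LinearMap.exists_monic_and_natDegree_eq_and_coeff_mem_pow_and_aeval_eq_zero`) for the
  endomorphism `T^k` with image in `(p)M` yields a monic relation `c = q(T^k)`, `c ≡ T^{kn} mod p`,
  so `c ≠ 0` kills `M` (the `p`-analogue of Greenberg's exercise "`X/TX` finite ⇒ `X` torsion",
  §1 p. 61, tree `isTorsion_of_forall_nsmul_eq_X_smul`);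
* §3 **`isTorsion_and_exists_hasUnitContent_of_finite_torsionBy`**: for `E/K` elliptic, `κ` the
  cyclotomic `ℤ_p`-extension with topological generator `γ` and any Pontryagin-dual datum `D`, if
  `Sel_{p^∞}(E/K_∞)[p]` is finite then `X = D.X` is finitely generated (tree
  `SelmerDualData.module_finite_of_isCyclotomic`, Nakayama), `X/pX` is finite (gen 11
  `finite_modN_characterModule_of_finite_torsionBy`, Pontryagin), hence `X` is torsion (§2) with
  `μ(X) = 0` (gen 11 `muInvariant_eq_zero_of_finite_modN`), i.e. `char_Λ X = (g)` with `g` of unit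
  content — literally the conclusion of Greenberg's Prop. 5.10 as typed in
  `Greenberg1999.prop510_isTorsion_hasUnitContent_of_gvPar`.

References: R. Greenberg, LNM 1716 (1999), §1 p. 61, Prop. 5.10 (PDF p. 147); Washington §13.2;
Matsumura Thm. 2.1 (Cayley–Hamilton).
-/

noncomputable section

open scoped Classical AddSubgroup

universe u

namespace Summit.BirchSwinnertonDyer.Rank1Residual.X2.SelmerCotorsionOfFiniteTorsion

open Literature.NumberTheory.EllipticCurves Polynomial

/-! ## §1. A finite `Λ`-module is killed by a power of `T` -/

section Finite

variable (p : ℕ) [Fact p.Prime]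

/-- `1 - T^n` (`n ≥ 1`) is a unit of `Λ = ℤ_p⟦T⟧` (constant coefficient `1`). [folklore] -/
theorem isUnit_one_sub_X_pow {n : ℕ} (hn : n ≠ 0) :
    IsUnit (1 - (PowerSeries.X : IwasawaAlgebra p) ^ n) := by
  rw [PowerSeries.isUnit_iff_constantCoeff, map_sub, map_one, map_pow, PowerSeries.constantCoeff_X,
    zero_pow hn, sub_zero]
  exact isUnit_one

/-- **A FINITE `Λ`-module is killed by a power of `T`.** For each `q`, two of the finitely many
`T^i • q` coincide, `T^i • q = T^j • q` (`i < j`), so `(1 − T^{j−i}) • T^i • q = 0` with `1 − T^{j−i}`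
a unit; a uniform exponent exists by finiteness. [folklore] -/
theorem exists_pow_X_smul_eq_zero_of_finite (Q : Type u) [AddCommGroup Q]
    [Module (IwasawaAlgebra p) Q] [Finite Q] :
    ∃ k : ℕ, ∀ q : Q, (PowerSeries.X : IwasawaAlgebra p) ^ k • q = 0 := by
  set T : IwasawaAlgebra p := PowerSeries.X with hT
  -- pointwise exponents
  have hpt : ∀ q : Q, ∃ k : ℕ, T ^ k • q = 0 := by
    intro q
    obtain ⟨i, j, hij, hq⟩ := Finite.exists_ne_map_eq_of_infinite (fun n : ℕ ↦ T ^ n • q)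
    -- arrange `i < j`
    wlog hlt : i < j generalizing i j
    · exact this j i hij.symm hq.symm (lt_of_le_of_ne (not_lt.1 hlt) hij.symm)
    obtain ⟨n, rfl⟩ := Nat.exists_eq_add_of_lt hlt
    refine ⟨i, ?_⟩
    have hq' : (1 - T ^ (n + 1)) • (T ^ i • q) = 0 := by
      rw [sub_smul, one_smul, smul_smul, ← pow_add, add_comm, ← add_assoc, sub_eq_zero]
      exact hq
    have hu := isUnit_one_sub_X_pow p (n := n + 1) (Nat.succ_ne_zero n)
    rw [← hT] at hu
    obtain ⟨u, hu'⟩ := hu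
    rw [← hu'] at hq'
    have h2 := congrArg (fun z ↦ ((u⁻¹ : (IwasawaAlgebra p)ˣ) : IwasawaAlgebra p) • z) hq'
    rw [← mul_smul, Units.inv_mul, one_smul, smul_zero] at h2
    exact h2
  choose k hk using hpt
  haveI : Fintype Q := Fintype.ofFinite Q
  refine ⟨Finset.univ.sup k, fun q ↦ ?_⟩
  obtain ⟨r, hr⟩ := Nat.exists_eq_add_of_le (Finset.le_sup (f := k) (Finset.mem_univ q))
  rw [hr, pow_add, mul_comm, mul_smul, hk, smul_zero]

end Finite

/-! ## §2. `M` finitely generated with `M/pM` finite ⟹ `M` is `Λ`-torsion -/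

section Torsion

variable (p : ℕ) [hp : Fact p.Prime]

/-- The reduction `Λ = ℤ_p⟦T⟧ → 𝔽_p⟦T⟧` kills `p`. [folklore] -/
theorem map_toZMod_natCast_p :
    PowerSeries.map (PadicInt.toZMod (p := p)) ((p : ℕ) : IwasawaAlgebra p) = 0 := by
  rw [map_natCast, ← map_natCast (PowerSeries.C (R := ZMod p)), ZMod.natCast_self, map_zero]

/-- The reduction kills every element of the ideal `(p) ⊆ Λ`. [folklore] -/
theorem map_toZMod_eq_zero_of_mem_span {a : IwasawaAlgebra p}
    (ha : a ∈ Ideal.span {((p : ℕ) : IwasawaAlgebra p)}) :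
    PowerSeries.map (PadicInt.toZMod (p := p)) a = 0 := by
  obtain ⟨t, rfl⟩ := Ideal.mem_span_singleton.1 ha
  rw [map_mul, map_toZMod_natCast_p, zero_mul]

/-- **`M` finitely generated over `Λ` with `M/pM` finite ⟹ `M` is a torsion `Λ`-module.**
§1 gives `T^k M ⊆ pM`; Cayley–Hamilton for the endomorphism `T^k` with image in `(p)M` gives a
monic `q` with lower coefficients in `(p)` and `q(T^k) M = 0`; reducing mod `p`,
`q(T^k) ≡ T^{k·deg q} ≠ 0`, so `q(T^k) ∈ Λ` is a non-zero element killing `M`. The `p`-adic twin of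
Greenberg's "if `X/TX` is finite, then `X` is a torsion `Λ`-module" (§1 p. 61).
[cite: GreenbergLNM1716, §1 p. 61 and Prop. 5.10 (proof, PDF p. 147)] -/
theorem isTorsion_of_finite_modN (M : Type u) [AddCommGroup M] [Module (IwasawaAlgebra p) M]
    [Module.Finite (IwasawaAlgebra p) M] [hfin : Finite (ModN M p)] :
    Module.IsTorsion (IwasawaAlgebra p) M := by
  have hpr : p.Prime := hp.out
  -- `P = pM` as a `Λ`-submodule and the finite `Λ`-module `M ⧸ P`
  let P : Submodule (IwasawaAlgebra p) M :=
    LinearMap.range (LinearMap.lsmul (IwasawaAlgebra p) M ((p : ℕ) : IwasawaAlgebra p))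
  have hP : ∀ x : M, x ∈ P ↔ ∃ y : M, ((p : ℕ) : IwasawaAlgebra p) • y = x := fun x ↦ by
    simp only [P, LinearMap.mem_range, LinearMap.lsmul_apply]
  haveI : Finite (M ⧸ P) := by
    let h : ModN M p →+ M ⧸ P :=
      ModN.liftEquiv.symm ⟨P.mkQ.toAddMonoidHom, fun m ↦ by
        change p • P.mkQ m = 0
        rw [← map_nsmul, ← Nat.cast_smul_eq_nsmul (IwasawaAlgebra p), Submodule.mkQ_apply,
          Submodule.Quotient.mk_eq_zero]
        exact (hP _).2 ⟨m, rfl⟩⟩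
    have hh : ∀ m : M, h (ModN.mkQ p m) = P.mkQ m := fun _ ↦ rfl
    refine Finite.of_surjective h fun y ↦ ?_
    obtain ⟨m, rfl⟩ := Submodule.mkQ_surjective P y
    exact ⟨ModN.mkQ p m, hh m⟩
  -- `T^k M ⊆ pM`
  obtain ⟨k, hk⟩ := exists_pow_X_smul_eq_zero_of_finite p (M ⧸ P)
  have hkM : ∀ x : M, ∃ y : M,
      (PowerSeries.X : IwasawaAlgebra p) ^ k • x = ((p : ℕ) : IwasawaAlgebra p) • y := by
    intro x
    have h1 : P.mkQ ((PowerSeries.X : IwasawaAlgebra p) ^ k • x) = 0 := by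
      rw [map_smul, hk]
    rw [Submodule.mkQ_apply, Submodule.Quotient.mk_eq_zero, hP] at h1
    obtain ⟨y, hy⟩ := h1
    exact ⟨y, hy.symm⟩
  -- Cayley–Hamilton for `f = T^k` with `range f ≤ (p) • M`
  set I : Ideal (IwasawaAlgebra p) := Ideal.span {((p : ℕ) : IwasawaAlgebra p)} with hI
  set f : Module.End (IwasawaAlgebra p) M :=
    algebraMap (IwasawaAlgebra p) (Module.End (IwasawaAlgebra p) M)
      ((PowerSeries.X : IwasawaAlgebra p) ^ k) with hf
  have hfI : LinearMap.range f ≤ I • ⊤ := by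
    rintro _ ⟨x, rfl⟩
    obtain ⟨y, hy⟩ := hkM x
    rw [hf, Module.algebraMap_end_apply, hy]
    exact Submodule.smul_mem_smul (Ideal.mem_span_singleton_self _) Submodule.mem_top
  obtain ⟨q, hmonic, -, hcoeff, hq⟩ :=
    LinearMap.exists_monic_and_natDegree_eq_and_coeff_mem_pow_and_aeval_eq_zero
      (IwasawaAlgebra p) f I hfI
  -- `c = q(T^k)` kills `M`
  set c : IwasawaAlgebra p := q.eval ((PowerSeries.X : IwasawaAlgebra p) ^ k) with hc
  have hkill : ∀ x : M, c • x = 0 := fun x ↦ by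
    have e := congrArg (fun g : Module.End (IwasawaAlgebra p) M ↦ g x) hq
    simp only [hf, Polynomial.aeval_algebraMap_apply_eq_algebraMap_eval,
      Module.algebraMap_end_apply, LinearMap.zero_apply] at e
    exact e
  -- `c ≡ T^{k · deg q} (mod p)`, hence `c ≠ 0`
  have hred : PowerSeries.map (PadicInt.toZMod (p := p)) c =
      (PowerSeries.X : PowerSeries (ZMod p)) ^ (k * q.natDegree) := by
    rw [hc, Polynomial.eval_eq_sum_range, map_sum, Finset.sum_range_succ, Finset.sum_eq_zero]
    · rw [zero_add, map_mul, map_pow, map_pow, PowerSeries.map_X, hmonic.coeff_natDegree, map_one,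
        one_mul, pow_mul]
    · intro i hi
      rw [Finset.mem_range] at hi
      have hmem : q.coeff i ∈ I := by
        have h := hcoeff i
        exact Ideal.pow_le_self (Nat.sub_ne_zero_of_lt hi) h
      rw [map_mul, map_toZMod_eq_zero_of_mem_span p hmem, zero_mul]
  have hc0 : c ≠ 0 := by
    intro h0
    have h1 := hred
    rw [h0, map_zero] at h1
    exact (pow_ne_zero _ PowerSeries.X_ne_zero) h1.symm
  intro x
  exact ⟨⟨c, mem_nonZeroDivisors_of_ne_zero hc0⟩, hkill x⟩

end Torsion

/-! ## §3. The conclusion of Greenberg's Prop. 5.10 from the finiteness of `Sel_∞[p]` -/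

section Selmer

open NumberField WeierstrassCurve Literature.NumberTheory.EllipticCurves.GreenbergVatsal2000
  Summit.BirchSwinnertonDyer.Rank1Residual.X2.MuTransferDerived
  Summit.BirchSwinnertonDyer.Rank1Residual.X2.MuVanishingOfFiniteModP

variable {K : Type u} [Field K] [NumberField K] (W : WeierstrassCurve K) [W.IsElliptic]
  {p : ℕ} [hp : Fact p.Prime] {κ : ZpExtension K p} {γ : Field.absoluteGaloisGroup K}

/-- **`Sel_{p^∞}(E/K_∞)[p]` finite ⟹ `X(E/K_∞)` is `Λ`-torsion and `char_Λ X(E/K_∞) = (g)` with `g`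
of unit content (`μ = 0`)** — for `E/K` elliptic, `κ` the CYCLOTOMIC `ℤ_p`-extension with topological
generator `γ` and EVERY Pontryagin-dual datum `D`: `X` is finitely generated (Nakayama, tree
`SelmerDualData.module_finite_of_isCyclotomic`), `X/pX ↪ Hom(Sel_∞[p], ℚ/ℤ)` is finite (gen 11),
so `X` is torsion (§2) with `μ(X) = 0` (GV Prop. (2.8), `μ`-half, gen 11), and the characteristic
ideal is principal (`Λ` a UFD). Greenberg: "This obviously implies the conclusion."
[cite: GreenbergLNM1716, Prop. 5.10 (proof, PDF p. 147)] -/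
theorem isTorsion_and_exists_hasUnitContent_of_finite_torsionBy (hκ : κ.IsCyclotomic)
    (hγ : κ.IsTopGenerator γ) (D : W.SelmerDualData κ γ) [Finite ((↥(W.selmerInfty κ))[(p : ℤ)])] :
    D.IsTorsion ∧ ∃ g : IwasawaAlgebra p, D.charIdeal = Ideal.span {g} ∧ HasUnitContent g := by
  haveI : Module.Finite (IwasawaAlgebra p) D.X :=
    SelmerDualData.module_finite_of_isCyclotomic (W := W) (κ := κ) hκ D hγ
  -- `X/pX` is finite
  haveI : Finite (ModN (CharacterModule (W.selmerInfty κ)) p) :=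
    finite_modN_characterModule_of_finite_torsionBy p
  let e : D.X ≃+ CharacterModule (W.selmerInfty κ) := AddEquiv.ofBijective D.toDual D.bijective
  haveI hfin : Finite (ModN D.X p) := Finite.of_equiv _ (modNEquiv e p).symm.toEquiv
  -- torsion and `μ = 0`
  have htors : D.IsTorsion := isTorsion_of_finite_modN p D.X
  have hμ : D.mu = 0 := muInvariant_eq_zero_of_finite_modN' p D.X htors hfin
  obtain ⟨g, hg⟩ := (charIdeal_isPrincipal_holds p D.X).principal
  have hg' : D.charIdeal = Ideal.span {g} := hg
  exact ⟨htors, g, hg', (mu_eq_zero_iff_hasUnitContent D htors hg').mp hμ⟩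

end Selmer

end Summit.BirchSwinnertonDyer.Rank1Residual.X2.SelmerCotorsionOfFiniteTorsion

end
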